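import Mathlib.Analysis.Real.Pi.Bounds
import Literature.AlgebraicGeometry.Frobenioids.CircleOpensConditionsAB
import Literature.AlgebraicGeometry.Frobenioids.CircleOpensCondClosures
import HarnessLib

/-!
# Frobenioids II, Lemma 3.2 (vi): conditions (a), (d) — 0-hypothesis INSTANCE FORMS at genuine pairs

S. Mochizuki, *The geometry of Frobenioids II: poly-Frobenioids*, Kyushu J. Math. **62** (2008)
401–460 [MochizukiFrdII2008], §3, Lemma 3.2 (vi), author's text pp. 25–26
[cite: MochizukiFrdII2008, Lem 3.2 (vi) pp.25-26]: for [nonempty] connected open `A ⊆ B ⊆ S¹` with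
`A ≠ B`, "(a) for any two `(A, B)`-subsets `A₁, A₂`, either `A₁ ⊆ A₂` or `A₂ ⊆ A₁`; … (d) If `B = S¹`,
then `B \ A` is of cardinality `≤ 1`. … Then (a) holds if and only if both (c) and (d) hold".

PROOF-ONLY companion (abc-iut cell, block F, KEY row INST59K2, seat abc-iut-f-002; 0 `def` /
`structure` / `instance` / notation, no `Prop` fact) of abc-iut-L1-t4's `CircleOpens.lean`, FACT-LIST
rows **F-0984** `CircleOpens.CondA` and **F-0987** `CircleOpens.CondD`.  State of the rows in the tree:
both are two-place CONDITIONS (hypothesis vocabulary of "continuously ordered"), their universal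
closures are REFUTED in the kernel even under the standing hypotheses (`not_condA_middle_arc`,
`not_condA_arc_univ`, `not_forall_setting_condA`; `not_forall_condD`, `not_forall_condD'`), and their
exact range is known BY NAME (`condA_arc_iff`, `condA_univ_iff`, `condA_iff_condC_and_condD`,
`condD_univ_iff`, `condD_of_ne_univ`).  The L-F kernel census (plan/LF-KERNEL-STATUS.tsv 2026-08-27,
col 14) found NO theorem whose conclusion HEAD is `CondA …` / `CondD …` with no hypothesis.

THIS FILE supplies exactly those, at GENUINE data of the printed setting (`Setting A B`, `A ≠ B`; no toy
carrier):
* `condA_arc_zero_one_zero_two` — (a) HOLDS for `A = exp(i·(0, 1)) ⊊ B = exp(i·(0, 2))` (shared left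
  endpoint: the `(A, B)`-subsets are the arcs `exp(i·(0, b'))`, `1 ≤ b' ≤ 2`, a chain);
* `condA_arc_one_two_zero_two` — (a) HOLDS for `A = exp(i·(1, 2)) ⊊ B = exp(i·(0, 2))` (shared right
  endpoint);
* `condA_compl_singleton_univ p` — (a) HOLDS for `A = S¹ ∖ {p} ⊊ B = S¹` (the only `(A, S¹)`-subsets are
  `A` and `S¹`);
* `condD_compl_singleton_univ p` — (d) HOLDS, NON-vacuously (`B = S¹`), for `A = S¹ ∖ {p}`:
  `S¹ ∖ A = {p}` has exactly one point;
* the degenerate corners `condA_univ_univ`, `condD_univ_univ` (`A = B = S¹`), and — LABELLED vacuous —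
  `condD_arc_one_two_zero_three` ((d) at the refuters' pair `exp(i·(1,2)) ⊊ exp(i·(0,3))`: `B ≠ S¹`, the
  antecedent of (d) is false; recorded only because that pair is the kernel's standing witness for
  `not_forall_condC` and sits on the (c)∧(e) side of (vi));
* `setting_and_ne_…` lemmas certifying that the three main pairs ARE instances of the printed standing
  hypotheses (so the certificates are not about degenerate binders).
Everything is `condA_arc_iff` / `condA_univ_iff` / `condD_univ_iff` BY NAME plus interval arithmetic;
nothing of `CircleOpens.lean` is restated or edited.  [FrdII] is refereed, undisputed mathematics; an
instance-form theorem about OUR typed statement is not a theorem about IUT in print; no side taken on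
[IUTchIII] Cor. 3.12; typed ≠ proved elsewhere, here PROVED = kernel-checked.
-/

namespace Literature.AlgebraicGeometry.Frobenioids

open Set Function Topology Real
open scoped Pointwise

noncomputable section

namespace CircleOpens

/-! ### The three pairs are genuine instances of the standing hypotheses of Lemma 3.2 (vi) -/

/-- `exp(i·(0, 1)) ⊊ exp(i·(0, 2))` is a `Setting` with `A ≠ B` (FrdII Lem. 3.2, standing hypotheses
p. 25). [cite: MochizukiFrdII2008, Lem 3.2 (vi) p.25] -/
theorem setting_and_ne_arc_zero_one_zero_two :
    Setting (Circle.exp '' Ioo 0 1) (Circle.exp '' Ioo 0 2) ∧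
      Circle.exp '' Ioo (0 : ℝ) 1 ≠ Circle.exp '' Ioo 0 2 := by
  refine ⟨⟨isConnected_exp_image_Ioo (by norm_num), isOpen_exp_image isOpen_Ioo,
    isConnected_exp_image_Ioo (by norm_num), isOpen_exp_image isOpen_Ioo,
    image_mono (Ioo_subset_Ioo le_rfl (by norm_num))⟩, fun h => ?_⟩
  have := (exp_image_Ioo_eq_iff (c := 0) (a₁ := 0) (b₁ := 1) (a₂ := 0) (b₂ := 2) (by norm_num)
    (by norm_num) le_rfl (by linarith [pi_gt_three]) le_rfl (by linarith [pi_gt_three])).mp h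
  norm_num at this

/-- `exp(i·(1, 2)) ⊊ exp(i·(0, 2))` is a `Setting` with `A ≠ B` (FrdII Lem. 3.2, standing hypotheses
p. 25). [cite: MochizukiFrdII2008, Lem 3.2 (vi) p.25] -/
theorem setting_and_ne_arc_one_two_zero_two :
    Setting (Circle.exp '' Ioo 1 2) (Circle.exp '' Ioo 0 2) ∧
      Circle.exp '' Ioo (1 : ℝ) 2 ≠ Circle.exp '' Ioo 0 2 := by
  refine ⟨⟨isConnected_exp_image_Ioo (by norm_num), isOpen_exp_image isOpen_Ioo,
    isConnected_exp_image_Ioo (by norm_num), isOpen_exp_image isOpen_Ioo,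
    image_mono (Ioo_subset_Ioo (by norm_num) le_rfl)⟩, fun h => ?_⟩
  have := (exp_image_Ioo_eq_iff (c := 0) (a₁ := 1) (b₁ := 2) (a₂ := 0) (b₂ := 2) (by norm_num)
    (by norm_num) (by norm_num) (by linarith [pi_gt_three]) le_rfl (by linarith [pi_gt_three])).mp h
  norm_num at this

/-- `S¹ ∖ {p} ⊊ S¹` is a `Setting` with `A ≠ B` (FrdII Lem. 3.2, standing hypotheses p. 25; the pair
of the printed proof of (vi), "`B \ A` of cardinality `≤ 1`"). [cite: MochizukiFrdII2008, Lem 3.2 (vi) p.26] -/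
theorem setting_and_ne_compl_singleton_univ (p : Circle) :
    Setting {p}ᶜ univ ∧ ({p}ᶜ : Set Circle) ≠ univ := by
  refine ⟨setting_univ (Circle.isPathConnected_compl_singleton p).isConnected isOpen_compl_singleton,
    fun h => ?_⟩
  have hp : p ∈ ({p}ᶜ : Set Circle) := h ▸ mem_univ p
  exact hp rfl

/-! ### Condition (a): 0-hypothesis instance forms (FACT-LIST F-0984) -/

/-- **F-0984, INSTANCE (genuine, shared left endpoint).** Condition (a) of Lemma 3.2 (vi) HOLDS for
`A = exp(i·(0, 1)) ⊊ B = exp(i·(0, 2))`: any two `(A, B)`-subsets are comparable (`condA_arc_iff`: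
inside a proper arc (a) ⟺ a shared endpoint). [cite: MochizukiFrdII2008, Lem 3.2 (vi)(a) p.25] -/
theorem condA_arc_zero_one_zero_two :
    Literature.AlgebraicGeometry.Frobenioids.CircleOpens.CondA
      (Circle.exp '' Ioo 0 1) (Circle.exp '' Ioo 0 2) :=
  (condA_arc_iff (c := 0) (d := 2) (a := 0) (b := 1) (by linarith [pi_gt_three]) le_rfl
    (by norm_num) (by norm_num)).mpr (Or.inl rfl)

/-- **F-0984, INSTANCE (genuine, shared right endpoint).** Condition (a) of Lemma 3.2 (vi) HOLDS for
`A = exp(i·(1, 2)) ⊊ B = exp(i·(0, 2))`. [cite: MochizukiFrdII2008, Lem 3.2 (vi)(a) p.25] -/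
theorem condA_arc_one_two_zero_two :
    Literature.AlgebraicGeometry.Frobenioids.CircleOpens.CondA
      (Circle.exp '' Ioo 1 2) (Circle.exp '' Ioo 0 2) :=
  (condA_arc_iff (c := 0) (d := 2) (a := 1) (b := 2) (by linarith [pi_gt_three]) (by norm_num)
    (by norm_num) le_rfl).mpr (Or.inr rfl)

/-- **F-0984, INSTANCE (genuine, `B = S¹`).** Condition (a) of Lemma 3.2 (vi) HOLDS for
`A = S¹ ∖ {p} ⊊ B = S¹`: `S¹ ∖ A = {p}` has at most one point (`condA_univ_iff`), i.e. the only
`(A, S¹)`-subsets are `A` and `S¹`. [cite: MochizukiFrdII2008, Lem 3.2 (vi)(a) p.25] -/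
theorem condA_compl_singleton_univ (p : Circle) :
    Literature.AlgebraicGeometry.Frobenioids.CircleOpens.CondA {p}ᶜ univ := by
  rw [condA_univ_iff (Circle.isPathConnected_compl_singleton p).isConnected isOpen_compl_singleton
    (setting_and_ne_compl_singleton_univ p).2]
  intro x hx y hy
  rw [Set.mem_sdiff, mem_compl_iff, mem_singleton_iff, not_not] at hx hy
  rw [hx.2, hy.2]

/-- **F-0984, INSTANCE (degenerate corner `A = B = S¹`).** Condition (a) holds for the pair `(S¹, S¹)`
(the only `(S¹, S¹)`-subset is `S¹`; `condA_of_eq`). [cite: MochizukiFrdII2008, Lem 3.2 (vi)(a) p.25] -/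
theorem condA_univ_univ :
    Literature.AlgebraicGeometry.Frobenioids.CircleOpens.CondA (univ : Set Circle) univ :=
  condA_of_eq rfl

/-! ### Condition (d): 0-hypothesis instance forms (FACT-LIST F-0987) -/

/-- **F-0987, INSTANCE (genuine and NON-vacuous: `B = S¹`).** Condition (d) of Lemma 3.2 (vi) HOLDS for
`A = S¹ ∖ {p}`, `B = S¹`: "`B \ A` is of cardinality `≤ 1`" — here `S¹ ∖ A = {p}`.
[cite: MochizukiFrdII2008, Lem 3.2 (vi)(d) p.26] -/
theorem condD_compl_singleton_univ (p : Circle) :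
    Literature.AlgebraicGeometry.Frobenioids.CircleOpens.CondD {p}ᶜ univ := by
  rw [condD_univ_iff]
  intro x hx y hy
  rw [Set.mem_sdiff, mem_compl_iff, mem_singleton_iff, not_not] at hx hy
  rw [hx.2, hy.2]

/-- **F-0987, INSTANCE (degenerate corner `A = B = S¹`, non-vacuous antecedent).** Condition (d) holds
for `(S¹, S¹)`: `S¹ ∖ S¹ = ∅`. [cite: MochizukiFrdII2008, Lem 3.2 (vi)(d) p.26] -/
theorem condD_univ_univ :
    Literature.AlgebraicGeometry.Frobenioids.CircleOpens.CondD (univ : Set Circle) univ := by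
  rw [condD_univ_iff, Set.sdiff_self]
  exact subsingleton_empty

/-- **F-0987, INSTANCE — LABELLED VACUOUS (antecedent `B = S¹` false).** At the kernel's standing
witness pair `A = exp(i·(1, 2)) ⊊ B = exp(i·(0, 3))` (`setting_arc_one_two_zero_three`, the refuter of
the closure of (c)), condition (d) holds because `B ≠ S¹` (`condD_of_ne_univ`); recorded for the census
only — the NON-vacuous certificate is `condD_compl_singleton_univ`.
[cite: MochizukiFrdII2008, Lem 3.2 (vi)(d) p.26] -/
theorem condD_arc_one_two_zero_three :
    Literature.AlgebraicGeometry.Frobenioids.CircleOpens.CondD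
      (Circle.exp '' Ioo 1 2) (Circle.exp '' Ioo 0 3) := by
  refine condD_of_ne_univ fun h => ?_
  have h0 : Circle.exp (0 : ℝ) ∈ Circle.exp '' Ioo (0 : ℝ) 3 := h ▸ mem_univ _
  obtain ⟨x, hx, hxe⟩ := h0
  have := Circle.exp_injOn_Ico (a := 0) (b := 0 + 2 * π) (by linarith [pi_gt_three])
    ⟨hx.1.le, by linarith [hx.2, pi_gt_three]⟩ ⟨le_rfl, by linarith [pi_gt_three]⟩ hxe
  exact hx.1.ne' this

/-! ### The printed equivalence, instantiated: (a) ⟺ (c) ∧ (d) at the three genuine pairs -/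

/-- At `A = S¹ ∖ {p} ⊊ S¹` all of (a), (c), (d) hold — the `B = S¹` branch of the printed
"(a) ⟺ (c) ∧ (d)" realised at data (`condA_iff_condC_and_condD` by name).
[cite: MochizukiFrdII2008, Lem 3.2 (vi) p.26] -/
theorem condA_condC_condD_compl_singleton_univ (p : Circle) :
    CondA {p}ᶜ univ ∧ CondC {p}ᶜ univ ∧ CondD ({p}ᶜ : Set Circle) univ :=
  ⟨condA_compl_singleton_univ p,
    ((condA_iff_condC_and_condD (setting_and_ne_compl_singleton_univ p).1
      (setting_and_ne_compl_singleton_univ p).2).mp (condA_compl_singleton_univ p)).1,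
    condD_compl_singleton_univ p⟩

/-- At `A = exp(i·(0, 1)) ⊊ B = exp(i·(0, 2))` both (a) and (c) ∧ (d) hold — the `B ≠ S¹` branch of the
printed "(a) ⟺ (c) ∧ (d)" realised at data. [cite: MochizukiFrdII2008, Lem 3.2 (vi) p.26] -/
theorem condA_condC_condD_arc_zero_one_zero_two :
    CondA (Circle.exp '' Ioo 0 1) (Circle.exp '' Ioo 0 2) ∧
      CondC (Circle.exp '' Ioo 0 1) (Circle.exp '' Ioo 0 2) ∧
        CondD (Circle.exp '' Ioo (0 : ℝ) 1) (Circle.exp '' Ioo 0 2) :=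
  ⟨condA_arc_zero_one_zero_two,
    (condA_iff_condC_and_condD setting_and_ne_arc_zero_one_zero_two.1
      setting_and_ne_arc_zero_one_zero_two.2).mp condA_arc_zero_one_zero_two⟩

end CircleOpens

end

end Literature.AlgebraicGeometry.Frobenioids
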